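import Mathlib
import Summits.Ventures.PercRepro2.ThreeTermAntipode
import Summits.Ventures.PercRepro2.ThreeTermPartFibre

/-!
# Three-terminal parts, IV b: EVERY typed part satisfies the typed Harris condition
(blind cell PercRepro2, night-3 g30, 2026-08-29; `proofs/NIGHT3-CERT.md` §39)

`typedCount_part_nonneg` (ThreeTermPartLaw.lean) gives row 2′TRI for core + any unmarked three-terminal
part from two hypotheses: a Harris-cone certificate on the core's table and the TYPED HARRIS condition
`TypedHarris πpat (partLaw S τ pat)` on the part's typed partition law (g29 checked it by kernel `decide`
for the eight star type patterns; g28's census found it on 240 gadgets).  Here it is proved for EVERY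
part — any edge set `S`, any internal structure, any type map `τ` — with no computation:

* the typed Harris sum at `(a, s)` is `Σ_{x y z} [typed ∧ pat x = a] · hq s (π (pat y)) (π (pat z))`
  (`harrisSum_eq`), and by the copy symmetry of the typed triples `hq` may be replaced by the
  unsymmetrised slack `hh` of ThreeTermAntipode.lean (`harrisSum_hh`);
* at a fixed copy 1 the inner sum is `#{y ∈ cube : y ∈ U_S, y ∈ U_S′} − #{y ∈ cube : y ∈ U_S, ant y ∈ U_S′}`
  (`sum_typed`, `ite_decomp`), which is `≥ 0` by the antipodal Harris inequality `antipodal_harris` as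
  soon as the up-set events are upper sets of configurations (`sum_hh_nonneg`, `typedHarris_of_upper`);
* the events `{y | πpat (pat y) ∈ U}` ARE upper sets: the three pattern bits are the block observables
  (`Conn` is monotone: `blockObs_mono`, `pm_mono`, `isUpperSet_pat`) and `πpat⁻¹ U` is an up-set of the
  bit cube for every up-set `U` of the partition lattice (`uL_mono`, `uR_mono`, kernel `decide`);
* **`typedHarris_part`**: `TypedHarris πpat (partLaw S τ (pat ends S e₁ e₂ e₃ t₁ t₂ t₃))` — NO hypotheses;
* **`typedCount_part_nonneg_of_cone`** / **`typedCount_part_nonneg_of_inCone5'`**: row 2′TRI on core +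
  ANY three-terminal part from the core's cone certificate ALONE (the pattern-world form, or the
  five-world certificate of certlp.py on the 5³ partition table).

So the part side of the gadget-law method is closed: the two-internal-vertex gadgets, the leaf bundles
`K_{3,n}` and every other part need no per-gadget check; what decides row 2′TRI on core + part is the
core's table.  Own work; standard axioms.
-/

namespace Summit.Ventures.PercRepro2

open Block ThreeTerm TypedStar

namespace Part

/-! ## Patterns are monotone in the configuration -/

section Mono

variable {V : Type*} {E : Type*} [DecidableEq E]

/-- The pattern with the three given bits. -/
def patOf (b0 b1 b2 : Bool) : Fin 8 :=
  ⟨b0.toNat + 2 * b1.toNat + 4 * b2.toNat, by cases b0 <;> cases b1 <;> cases b2 <;> decide⟩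

omit [DecidableEq E] in
/-- `bits` is `patOf` of the three coordinates. -/
lemma bits_eq_patOf (s0 s1 s2 : E) (a : Config E) : bits s0 s1 s2 a = patOf (a s0) (a s1) (a s2) := by
  apply Fin.ext
  simp only [bits, patOf]
  cases a s0 <;> cases a s1 <;> cases a s2 <;> simp

omit [DecidableEq E] in
/-- The block observable is monotone in the configuration. -/
lemma blockObs_mono (ends : E → Sym2 V) (S : Set E) [DecidablePred (· ∈ S)] (u v : V)
    {ω ω' : Config E} (h : ω ≤ ω') : blockObs ends S u v ω ≤ blockObs ends S u v ω' := by
  by_cases hω : blockObs ends S u v ω = true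
  · rw [hω]
    have hc := (blockObs_eq_true_iff ends S u v ω).1 hω
    have hle : SepPair.restrictTo S ω ≤ SepPair.restrictTo S ω' := by
      intro e
      have h1 := h e
      simp only [SepPair.restrictTo]
      cases hx : ω e <;> cases hy : ω' e <;> simp_all [Bool.le_iff_imp]
    exact le_of_eq ((blockObs_eq_true_iff ends S u v ω').2 (conn_mono hle hc)).symm
  · simp only [Bool.not_eq_true] at hω
    rw [hω]
    exact Bool.false_le _

/-- The part map is monotone. -/
lemma pm_mono (ends : E → Sym2 V) (S : Set E) [DecidablePred (· ∈ S)] (e₁ e₂ e₃ : E) (t₁ t₂ t₃ : V)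
    {ω ω' : Config E} (h : ω ≤ ω') : pm ends S e₁ e₂ e₃ t₁ t₂ t₃ ω ≤ pm ends S e₁ e₂ e₃ t₁ t₂ t₃ ω' := by
  intro e
  simp only [pm, partMap]
  split_ifs
  · exact blockObs_mono ends S t₁ t₂ h
  · exact blockObs_mono ends S t₁ t₃ h
  · exact blockObs_mono ends S t₂ t₃ h
  · exact le_rfl
  · exact h e

/-- An event of the pattern given by a bit-monotone predicate is an upper set. -/
lemma isUpperSet_pat (ends : E → Sym2 V) (S : Finset E) (e₁ e₂ e₃ : E) (t₁ t₂ t₃ : V)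
    (P : Fin 8 → Bool)
    (hP : ∀ b0 b1 b2 b0' b1' b2' : Bool, b0 ≤ b0' → b1 ≤ b1' → b2 ≤ b2' →
      P (patOf b0 b1 b2) = true → P (patOf b0' b1' b2') = true) :
    IsUpperSet {y : Config E | P (pat ends S e₁ e₂ e₃ t₁ t₂ t₃ y) = true} := by
  intro y y' hle hy
  simp only [Set.mem_setOf_eq, pat, bits_eq_patOf] at hy ⊢
  have hm := pm_mono ends (↑S) e₁ e₂ e₃ t₁ t₂ t₃ hle
  exact hP _ _ _ _ _ _ (hm e₁) (hm e₂) (hm e₃) hy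

/-- `πpat⁻¹ U_S` is an up-set of the bit cube, for every left up-set. -/
lemma uL_mono : ∀ (s : Fin 9) (b0 b1 b2 b0' b1' b2' : Bool), b0 ≤ b0' → b1 ≤ b1' → b2 ≤ b2' →
    uL s (πpat (patOf b0 b1 b2)) = true → uL s (πpat (patOf b0' b1' b2')) = true := by
  decide

/-- `πpat⁻¹ U_S′` is an up-set of the bit cube, for every right up-set. -/
lemma uR_mono : ∀ (s : Fin 9) (b0 b1 b2 b0' b1' b2' : Bool), b0 ≤ b0' → b1 ≤ b1' → b2 ≤ b2' →
    uR s (πpat (patOf b0 b1 b2)) = true → uR s (πpat (patOf b0' b1' b2')) = true := by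
  decide

end Mono

/-! ## The typed Harris sum as a sum over copy 1, and the theorem -/

section Assemble

variable {E : Type*} [Fintype E] [DecidableEq E]

/-- A double sum over `Fin 8` of a fibre indicator collapses. -/
lemma sum_collapse2 (f : Fin 8 → Fin 8 → ℚ) (j k : Fin 8) :
    (∑ b : Fin 8, ∑ c : Fin 8, if j = b ∧ k = c then f b c else 0) = f j k := by
  rw [Fintype.sum_eq_single j (fun b hb => Finset.sum_eq_zero fun c _ => by simp [Ne.symm hb])]
  rw [Fintype.sum_eq_single k (fun c hc => by simp [Ne.symm hc])]
  simp

/-- Commuting two outer sums past three inner sums. -/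
lemma sum23_comm {A B X Y Z : Type*} [Fintype A] [Fintype B] [Fintype X] [Fintype Y] [Fintype Z]
    (f : A → B → X → Y → Z → ℚ) :
    (∑ a, ∑ b, ∑ x, ∑ y, ∑ z, f a b x y z) = ∑ x, ∑ y, ∑ z, ∑ a, ∑ b, f a b x y z :=
  calc (∑ a, ∑ b, ∑ x, ∑ y, ∑ z, f a b x y z)
      = ∑ u : A × B, ∑ v : X × Y × Z, f u.1 u.2 v.1 v.2.1 v.2.2 := by
        simp only [Fintype.sum_prod_type]
    _ = ∑ v : X × Y × Z, ∑ u : A × B, f u.1 u.2 v.1 v.2.1 v.2.2 := Finset.sum_comm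
    _ = ∑ x, ∑ y, ∑ z, ∑ a, ∑ b, f a b x y z := by
        simp only [Fintype.sum_prod_type]

omit [Fintype E] [DecidableEq E] in
/-- The typed-triple condition is symmetric in copies 2 and 3. -/
lemma typed_swap23 (S : Finset E) (τ : E → ℕ) (x y z : Config E) :
    ((SuppOn S x ∧ SuppOn S y ∧ SuppOn S z) ∧ ∀ e ∈ S, openCount x y z e = τ e) ↔
      ((SuppOn S x ∧ SuppOn S z ∧ SuppOn S y) ∧ ∀ e ∈ S, openCount x z y e = τ e) := by
  simp only [openCount_swap23 x y z]
  constructor <;> rintro ⟨⟨h1, h2, h3⟩, h4⟩ <;> exact ⟨⟨h1, h3, h2⟩, h4⟩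

/-- **The typed Harris sum as a sum over typed triples**: `Σ_{b c} hq s (π b) (π c) · partLaw a b c
= Σ_{x y z} [typed ∧ pat x = a] · hq s (π (pat y)) (π (pat z))`. -/
lemma harrisSum_eq (S : Finset E) (τ : E → ℕ) (pat : Config E → Fin 8) (π : Fin 8 → Fin 5) (a : Fin 8)
    (s : Fin 9) :
    (∑ b : Fin 8, ∑ c : Fin 8, hq s (π b) (π c) * partLaw S τ pat a b c) =
      ∑ x : Config E, ∑ y : Config E, ∑ z : Config E,
        if ((SuppOn S x ∧ SuppOn S y ∧ SuppOn S z) ∧ ∀ e ∈ S, openCount x y z e = τ e) ∧ pat x = a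
          then hq s (π (pat y)) (π (pat z)) else 0 := by
  simp only [partLaw, Finset.mul_sum]
  rw [sum23_comm]
  refine Finset.sum_congr rfl fun x _ => Finset.sum_congr rfl fun y _ => Finset.sum_congr rfl fun z _ => ?_
  by_cases h : ((SuppOn S x ∧ SuppOn S y ∧ SuppOn S z) ∧ ∀ e ∈ S, openCount x y z e = τ e) ∧ pat x = a
  · rw [if_pos h, ← sum_collapse2 (fun b c => hq s (π b) (π c)) (pat y) (pat z)]
    refine Finset.sum_congr rfl fun b _ => Finset.sum_congr rfl fun c _ => ?_
    by_cases hbc : pat y = b ∧ pat z = c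
    · rw [if_pos hbc, if_pos ⟨h.1, h.2, hbc.1, hbc.2⟩, mul_one]
    · rw [if_neg hbc, if_neg (fun h' => hbc ⟨h'.2.2.1, h'.2.2.2⟩), mul_zero]
  · rw [if_neg h]
    refine Finset.sum_eq_zero fun b _ => Finset.sum_eq_zero fun c _ => ?_
    rw [if_neg (fun h' => h ⟨h'.1, h'.2.1⟩), mul_zero]

/-- **The typed Harris sum with the unsymmetrised slack** (copy symmetry of the typed triples). -/
lemma harrisSum_hh (S : Finset E) (τ : E → ℕ) (pat : Config E → Fin 8) (π : Fin 8 → Fin 5) (a : Fin 8)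
    (s : Fin 9) :
    (∑ b : Fin 8, ∑ c : Fin 8, hq s (π b) (π c) * partLaw S τ pat a b c) =
      ∑ x : Config E, ∑ y : Config E, ∑ z : Config E,
        if ((SuppOn S x ∧ SuppOn S y ∧ SuppOn S z) ∧ ∀ e ∈ S, openCount x y z e = τ e) ∧ pat x = a
          then hh s (π (pat y)) (π (pat z)) else 0 := by
  rw [harrisSum_eq]
  refine Finset.sum_congr rfl fun x _ => ?_
  have hswap : (∑ y : Config E, ∑ z : Config E,
      if ((SuppOn S x ∧ SuppOn S y ∧ SuppOn S z) ∧ ∀ e ∈ S, openCount x y z e = τ e) ∧ pat x = a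
        then hh s (π (pat z)) (π (pat y)) else 0) =
      ∑ y : Config E, ∑ z : Config E,
        if ((SuppOn S x ∧ SuppOn S y ∧ SuppOn S z) ∧ ∀ e ∈ S, openCount x y z e = τ e) ∧ pat x = a
          then hh s (π (pat y)) (π (pat z)) else 0 := by
    rw [Finset.sum_comm]
    refine Finset.sum_congr rfl fun z _ => Finset.sum_congr rfl fun y _ => ?_
    rw [if_congr (and_congr_left' (typed_swap23 S τ x y z)) rfl rfl]
  have h2 : ∀ y z : Config E,
      (if ((SuppOn S x ∧ SuppOn S y ∧ SuppOn S z) ∧ ∀ e ∈ S, openCount x y z e = τ e) ∧ pat x = a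
        then hq s (π (pat y)) (π (pat z)) else 0) =
      ((if ((SuppOn S x ∧ SuppOn S y ∧ SuppOn S z) ∧ ∀ e ∈ S, openCount x y z e = τ e) ∧ pat x = a
        then hh s (π (pat y)) (π (pat z)) else 0) +
       (if ((SuppOn S x ∧ SuppOn S y ∧ SuppOn S z) ∧ ∀ e ∈ S, openCount x y z e = τ e) ∧ pat x = a
        then hh s (π (pat z)) (π (pat y)) else 0)) / 2 := by
    intro y z
    split_ifs
    · exact hq_eq_hh s _ _
    · norm_num
  simp only [h2, Finset.sum_add_distrib, ← Finset.sum_div]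
  rw [hswap]
  ring

/-- The pointwise decomposition of the antipodal term. -/
lemma ite_decomp (p q r t : Prop) [Decidable p] [Decidable q] [Decidable r] [Decidable t] :
    (if p then (if q then (1 : ℚ) else 0) * ((if r then 1 else 0) - (if t then 1 else 0)) else 0) =
      (if p ∧ q ∧ r then 1 else 0) - (if p ∧ q ∧ t then 1 else 0) := by
  by_cases hp : p <;> by_cases hq : q <;> by_cases hr : r <;> by_cases ht : t <;> simp [hp, hq, hr, ht]

/-- **The inner sum at a fixed copy 1 is nonnegative** (the antipodal Harris inequality). -/
lemma sum_hh_nonneg (S : Finset E) (τ : E → ℕ) (pat : Config E → Fin 8) (π : Fin 8 → Fin 5) (s : Fin 9)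
    (hL : IsUpperSet {y : Config E | uL s (π (pat y)) = true})
    (hR : IsUpperSet {y : Config E | uR s (π (pat y)) = true}) (x : Config E) :
    0 ≤ ∑ y : Config E, ∑ z : Config E,
      if (SuppOn S x ∧ SuppOn S y ∧ SuppOn S z) ∧ ∀ e ∈ S, openCount x y z e = τ e
        then hh s (π (pat y)) (π (pat z)) else 0 := by
  by_cases hx : SuppOn S x ∧ Adm S τ x
  · rw [sum_typed S τ x hx.1 hx.2]
    have key := antipodal_harris S τ x (fun y => uL s (π (pat y)) = true) (fun y => uR s (π (pat y)) = true) hL hR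
    have e : (∑ y : Config E, if InCube S τ x y then hh s (π (pat y)) (π (pat (ant S τ x y))) else 0) =
        (∑ y : Config E, if InCube S τ x y ∧ uL s (π (pat y)) = true ∧ uR s (π (pat y)) = true
          then (1 : ℚ) else 0) -
        ∑ y : Config E, if InCube S τ x y ∧ uL s (π (pat y)) = true ∧ uR s (π (pat (ant S τ x y))) = true
          then (1 : ℚ) else 0 := by
      rw [← Finset.sum_sub_distrib]
      refine Finset.sum_congr rfl fun y _ => ?_
      simp only [hh]
      exact ite_decomp _ _ _ _
    rw [e]
    exact sub_nonneg.2 key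
  · refine Finset.sum_nonneg fun y _ => Finset.sum_nonneg fun z _ => ?_
    rw [if_neg (not_typed S τ x hx y z)]

/-- **THE TYPED HARRIS CONDITION FROM MONOTONICITY**: if every up-set event `{y | π (pat y) ∈ U}` is an
upper set of configurations, the typed partition law of `S` satisfies the typed Harris condition — for
every type map `τ`. -/
theorem typedHarris_of_upper (S : Finset E) (τ : E → ℕ) (pat : Config E → Fin 8) (π : Fin 8 → Fin 5)
    (hL : ∀ s, IsUpperSet {y : Config E | uL s (π (pat y)) = true})
    (hR : ∀ s, IsUpperSet {y : Config E | uR s (π (pat y)) = true}) :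
    TypedHarris π (partLaw S τ pat) := by
  intro a s
  rw [harrisSum_hh]
  refine Finset.sum_nonneg fun x _ => ?_
  by_cases ha : pat x = a
  · calc (0 : ℚ) ≤ _ := sum_hh_nonneg S τ pat π s (hL s) (hR s) x
      _ = _ := by
        refine Finset.sum_congr rfl fun y _ => Finset.sum_congr rfl fun z _ => ?_
        rw [if_congr (and_iff_left ha) rfl rfl]
  · refine Finset.sum_nonneg fun y _ => Finset.sum_nonneg fun z _ => ?_
    rw [if_neg (fun h => ha h.2)]

end Assemble

/-! ## The theorem for every three-terminal part, and the corollaries -/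

section Main

variable {V : Type*} {E : Type*} [Fintype E] [DecidableEq E]

/-- **EVERY TYPED THREE-TERMINAL PART SATISFIES THE TYPED HARRIS CONDITION** — any edge set `S`, any
pattern data, any type map `τ`: no hypothesis at all. -/
theorem typedHarris_part (ends : E → Sym2 V) (S : Finset E) (e₁ e₂ e₃ : E) (t₁ t₂ t₃ : V) (τ : E → ℕ) :
    TypedHarris πpat (partLaw S τ (pat ends S e₁ e₂ e₃ t₁ t₂ t₃)) :=
  typedHarris_of_upper S τ _ πpat
    (fun s => isUpperSet_pat ends S e₁ e₂ e₃ t₁ t₂ t₃ (fun i => uL s (πpat i)) (uL_mono s))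
    (fun s => isUpperSet_pat ends S e₁ e₂ e₃ t₁ t₂ t₃ (fun i => uR s (πpat i)) (uR_mono s))

/-- **Row 2′TRI for core + ANY three-terminal part from the core's cone certificate alone** (the
pattern-world form `InConeP πpat (cubicOf partTable)`). -/
theorem typedCount_part_nonneg_of_cone {ends : E → Sym2 V} {W : Set V} {t₁ t₂ t₃ : V}
    (hW : IsPart ends W t₁ t₂ t₃) {S : Finset E} (hS : ∀ e, e ∈ S ↔ e ∈ touches ends W)
    {e₁ e₂ e₃ : E} (h1 : e₁ ∈ S) (h2 : e₂ ∈ S) (h3 : e₃ ∈ S) (h12 : e₁ ≠ e₂) (h13 : e₁ ≠ e₃)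
    (h23 : e₂ ≠ e₃) {o a₁ a₂ a₃ b : V} (ho : o ∉ W) (ha₁ : a₁ ∉ W) (ha₂ : a₂ ∉ W) (ha₃ : a₃ ∉ W)
    (hb : b ∉ W) {F : Finset E} (hd : Disjoint F S) (z : Config E) (τ : E → ℕ)
    (hcone : InConeP πpat (cubicOf (partTable ends S e₁ e₂ e₃ t₁ t₂ t₃ o a₁ a₂ a₃ b F z τ))) :
    0 ≤ typedCount (F ∪ S) z τ (CovForm.K3 (R := ℚ) ends o a₁ a₂ a₃ b) :=
  typedCount_part_nonneg hW hS h1 h2 h3 h12 h13 h23 ho ha₁ ha₂ ha₃ hb hd z τ hcone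
    (typedHarris_part ends S e₁ e₂ e₃ t₁ t₂ t₃ τ)

/-- **Row 2′TRI for core + ANY three-terminal part from a certificate on the 5³ partition table alone**
(the five-world form of certlp.py, `ThreeTerm.InCone`). -/
theorem typedCount_part_nonneg_of_inCone5' {ends : E → Sym2 V} {W : Set V} {t₁ t₂ t₃ : V}
    (hW : IsPart ends W t₁ t₂ t₃) {S : Finset E} (hS : ∀ e, e ∈ S ↔ e ∈ touches ends W)
    {e₁ e₂ e₃ : E} (h1 : e₁ ∈ S) (h2 : e₂ ∈ S) (h3 : e₃ ∈ S) (h12 : e₁ ≠ e₂) (h13 : e₁ ≠ e₃)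
    (h23 : e₂ ≠ e₃) {o a₁ a₂ a₃ b : V} (ho : o ∉ W) (ha₁ : a₁ ∉ W) (ha₂ : a₂ ∉ W) (ha₃ : a₃ ∉ W)
    (hb : b ∉ W) {F : Finset E} (hd : Disjoint F S) (z : Config E) (τ : E → ℕ)
    (hcone : InCone (fun ν => ∑ p : Fin 5, ∑ q : Fin 5, ∑ r : Fin 5,
      partTable5 ends S e₁ e₂ e₃ t₁ t₂ t₃ o a₁ a₂ a₃ b F z τ p q r * mono p q r ν)) :
    0 ≤ typedCount (F ∪ S) z τ (CovForm.K3 (R := ℚ) ends o a₁ a₂ a₃ b) :=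
  typedCount_part_nonneg_of_inCone5 hW hS h1 h2 h3 h12 h13 h23 ho ha₁ ha₂ ha₃ hb hd z τ hcone
    (typedHarris_part ends S e₁ e₂ e₃ t₁ t₂ t₃ τ)

end Main

end Part

end Summit.Ventures.PercRepro2
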